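import Mathlib.AlgebraicGeometry.Morphisms.FlatMono
import Mathlib.AlgebraicGeometry.Morphisms.Separated
import Mathlib.AlgebraicGeometry.Morphisms.SchemeTheoreticallyDominant
import HarnessLib

/-!
# A flat, separated morphism of finite presentation which is an isomorphism over a
# schematically dense open is an open immersion (Stacks 081M)

Topic: `Literature/AlgebraicGeometry/Morphisms`. The Stacks Project, Tag 081M (More on Flatness,
Lemma 38.11.5): "Let `f : X → S` be a morphism of schemes and `U ⊂ S` an open. If (1) `f` is
separated, locally of finite type, and flat, (2) `f⁻¹(U) → U` is an isomorphism, and (3) `U ⊂ S`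
is retrocompact and scheme theoretically dense, then `f` is an open immersion." This is the last
step of Tag 081S (Lemma 38.31.3: after Raynaud–Gruson flattening, the strict transform of a
morphism which is an isomorphism over `U` becomes an open subscheme of the blown-up base), which
in turn is used three times in the proof of Nagata's compactification theorem (Tag 0F41, through
Lemmas 0F3W, 0F3X, 0F3Z).

We PROVE the variant in which hypothesis (3) is replaced by what the printed proof extracts from
it — that the open `f⁻¹(U) ⊆ X` is retrocompact and schematically dense in `X` (for `f` flat this
follows from (3) by flat base change; for a strict transform it holds by construction) — and in
which `f` is assumed locally of finite presentation (in 081S this is supplied by the flattening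
theorem 081R itself; the printed proof obtains it from (3) via Tag 081P). The printed proof then
argues through quasi-finiteness and étale localisation; we replace this by the diagonal: the
diagonal `Δ : X → X ×_S X` is a closed immersion (`f` separated) through which the schematically
dense open `pr₁⁻¹(f⁻¹ U)` factors (over `U` the two projections agree because `f⁻¹(U) → U` is a
monomorphism), so `ker Δ = 0`, `Δ` is an isomorphism, `f` is a monomorphism, and a flat
monomorphism locally of finite presentation is an open immersion (Mathlib
`IsOpenImmersion.of_flat_of_mono`, Stacks 06NC/025G).

* `fst_eq_snd_on_preimage` — on `pr₁⁻¹(f⁻¹U) ⊆ X ×_S X` the two projections agree;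
* `mono_of_isIso_morphismRestrict` — `f` separated with `f⁻¹(U) ↪ X` quasi-compact and
  scheme-theoretically dominant, `f` flat, `f|_U` an isomorphism ⇒ `f` is a monomorphism;
* `isOpenImmersion_of_flat_of_isIso_morphismRestrict` — **Stacks 081M** (variant above).

Everything is proved; no named facts.

## References

* The Stacks Project, Tag 081M (More on Flatness, Lemma 38.11.5), Tag 06NC. [StacksProject]
-/

noncomputable section

-- Mathlib's pull-back API is stated through `abbrev`s over `limit`; as in Mathlib's own
-- algebraic-geometry files we let `simp`/unification see through them.
set_option backward.isDefEq.respectTransparency false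

universe u

open CategoryTheory CategoryTheory.Limits AlgebraicGeometry TopologicalSpace

namespace Literature.AlgebraicGeometry.Morphisms

variable {X S : Scheme.{u}} (f : X ⟶ S) (U : S.Opens)

/-- **Over `U`, the two projections of `X ×_S X` agree when `f⁻¹(U) → U` is a monomorphism**:
on the open `W = pr₁⁻¹(f⁻¹ U)` both projections land in `f⁻¹(U)` and agree after `f`.
[cite: StacksProject, Tag 081M (proof, variant)] -/
theorem fst_eq_snd_on_preimage [Mono (f ∣_ U)] :
    ((pullback.fst f f) ⁻¹ᵁ (f ⁻¹ᵁ U)).ι ≫ pullback.fst f f =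
      ((pullback.fst f f) ⁻¹ᵁ (f ⁻¹ᵁ U)).ι ≫ pullback.snd f f := by
  set W : (pullback f f).Opens := (pullback.fst f f) ⁻¹ᵁ (f ⁻¹ᵁ U) with hW
  -- both composites land in `f⁻¹(U)`
  have h₁ : Set.range (W.ι ≫ pullback.fst f f) ⊆ Set.range (f ⁻¹ᵁ U).ι := by
    rintro _ ⟨w, rfl⟩
    rw [Scheme.Opens.range_ι]
    exact w.2
  have h₂ : Set.range (W.ι ≫ pullback.snd f f) ⊆ Set.range (f ⁻¹ᵁ U).ι := by
    rintro _ ⟨w, rfl⟩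
    rw [Scheme.Opens.range_ι]
    have hw : f (pullback.fst f f (W.ι w)) ∈ U := w.2
    show f (pullback.snd f f (W.ι w)) ∈ U
    rw [← Scheme.Hom.comp_apply, ← Scheme.Hom.comp_apply, ← pullback.condition,
      Scheme.Hom.comp_apply, Scheme.Hom.comp_apply]
    exact hw
  -- lift them through `f⁻¹(U)`; the lifts agree after the monomorphism `f⁻¹(U) → U ↪ S`
  have key : IsOpenImmersion.lift (f ⁻¹ᵁ U).ι _ h₁ = IsOpenImmersion.lift (f ⁻¹ᵁ U).ι _ h₂ := by
    rw [← cancel_mono (f ∣_ U), ← cancel_mono U.ι, Category.assoc, Category.assoc,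
      morphismRestrict_ι, IsOpenImmersion.lift_fac_assoc, IsOpenImmersion.lift_fac_assoc,
      Category.assoc, Category.assoc, pullback.condition]
  rw [← IsOpenImmersion.lift_fac (f ⁻¹ᵁ U).ι _ h₁, ← IsOpenImmersion.lift_fac (f ⁻¹ᵁ U).ι _ h₂, key]

/-- **A separated flat morphism which is an isomorphism over `U`, with `f⁻¹(U)` retrocompact and
schematically dense in `X`, is a monomorphism**: its diagonal, a closed immersion, receives the
schematically dense open `pr₁⁻¹(f⁻¹ U)` (schematic density by flat base change along `pr₁`),
hence has trivial kernel and is an isomorphism. [cite: StacksProject, Tag 081M (proof, variant)] -/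
theorem mono_of_isIso_morphismRestrict [IsSeparated f] [Flat f]
    [QuasiCompact (f ⁻¹ᵁ U).ι] [IsSchemeTheoreticallyDominant (f ⁻¹ᵁ U).ι]
    [IsIso (f ∣_ U)] : Mono f := by
  rw [← pullback.isIso_diagonal_iff, IsClosedImmersion.isIso_iff_ker_eq_bot, ← le_bot_iff]
  set W : (pullback f f).Opens := (pullback.fst f f) ⁻¹ᵁ (f ⁻¹ᵁ U) with hW
  -- `W ↪ X ×_S X` is scheme-theoretically dominant (flat base change of `f⁻¹(U) ↪ X`)
  haveI : IsSchemeTheoreticallyDominant W.ι :=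
    IsSchemeTheoreticallyDominant.of_isPullback
      (isPullback_morphismRestrict (pullback.fst f f) (f ⁻¹ᵁ U))
  -- `W ↪ X ×_S X` factors through the diagonal
  have hfac : (W.ι ≫ pullback.fst f f) ≫ pullback.diagonal f = W.ι := by
    apply pullback.hom_ext
    · simp only [Category.assoc, pullback.diagonal_fst, Category.comp_id]
    · simp only [Category.assoc, pullback.diagonal_snd, Category.comp_id]
      exact fst_eq_snd_on_preimage f U
  calc (pullback.diagonal f).ker
      ≤ ((W.ι ≫ pullback.fst f f) ≫ pullback.diagonal f).ker := Scheme.Hom.le_ker_comp _ _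
    _ = ⊥ := by rw [hfac]; exact IsSchemeTheoreticallyDominant.ker_eq_bot _

/-- **Stacks 081M** (variant, see the module docstring): a separated, flat morphism locally of
finite presentation which is an isomorphism over an open `U` of the target such that `f⁻¹(U)` is
retrocompact and schematically dense in `X` is an open immersion.
[cite: StacksProject, Tag 081M] -/
theorem isOpenImmersion_of_flat_of_isIso_morphismRestrict [IsSeparated f] [Flat f]
    [LocallyOfFinitePresentation f] [QuasiCompact (f ⁻¹ᵁ U).ι]
    [IsSchemeTheoreticallyDominant (f ⁻¹ᵁ U).ι] [IsIso (f ∣_ U)] : IsOpenImmersion f :=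
  haveI := mono_of_isIso_morphismRestrict f U
  IsOpenImmersion.of_flat_of_mono f

end Literature.AlgebraicGeometry.Morphisms

end
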